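import Literature.Topology.FourManifolds.NormalRetraction
import Mathlib.Geometry.Manifold.WhitneyEmbedding
import Mathlib.Geometry.Manifold.SmoothApprox
import Mathlib.Topology.Homotopy.Basic
import Mathlib.Topology.MetricSpace.Thickening
import HarnessLib

/-!
# Smoothing a homotopy into a compact manifold (rel ends)

Topic `Literature/Topology/FourManifolds`; the approximation half of the tree's proof of the leaf
`Literature.Topology.FourManifolds.Milnor1965_isAmbientIsotopic_of_simplyConnected` of
`HCobordismAuxiliaryPair.lean` (Whitney's theorem that homotopic embedded circles in a manifold of
dimension `≥ 4` are isotopic starts from a *smooth* homotopy).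

* `Literature.Topology.FourManifolds.exists_contMDiff_homotopy_of_homotopic` — let `M` be a
  compact Hausdorff manifold, `V` a compact Hausdorff manifold without boundary modelled on
  `ℝⁿ`, and `e₀ e₁ : C(M, V)` smooth maps which are homotopic as continuous maps.  Then there is
  a smooth map `H : ℝ × M → V` with `H (t, ·) = e₀` for `t ≤ 1/4` and `H (t, ·) = e₁` for
  `t ≥ 3/4`.

**Proof** (the classical smoothing of homotopies, e.g. Hirsch, *Differential Topology* (1976),
Ch. 8 §1 Ex. 2 / Ch. 2 §2 Thm. 2.6 with Ch. 4 §5: "homotopic smooth maps are smoothly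
homotopic").  Embed `V ⊆ ℝᴺ` (Mathlib's Whitney embedding `exists_embedding_euclidean_of_compact`)
with a smooth normal retraction `r : T → V` of an open tube `T ⊇ V` (the tree's
`Literature.Topology.FourManifolds.exists_normalRetraction`, `NormalRetraction.lean`).
Reparametrise the continuous homotopy to be `e₀` for `t ≤ 1/3` and `e₁` for `t ≥ 2/3`, read it in
`ℝᴺ`, and approximate it uniformly within the tube margin by a smooth map which is left unchanged
on the closed set `{t ≤ 1/4} ∪ {t ≥ 3/4}` near which it is already smooth (Mathlib's
`Continuous.exists_contMDiff_approx_and_eqOn`, smooth partitions of unity); retract.  Everything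
here is proved; no definitions, no named facts.

## References

* M. W. Hirsch, *Differential Topology*, GTM 33 (1976), Ch. 2 §2 (Thm. 2.6), Ch. 4 §5
  (tubular neighbourhoods and retractions), Ch. 8 §1. [HirschDT1976]
* H. Whitney, *Differentiable manifolds*, Ann. of Math. (2) 37 (1936), 645–680, §I (imbedding
  in Euclidean space), §II. [Whitney1936]
-/

open scoped Manifold ContDiff Topology
open Function Set Filter

noncomputable section

namespace Literature.Topology.FourManifolds

/-- **Smoothing a homotopy rel ends.**  Let `M` be a compact Hausdorff `C^∞` manifold (model
with corners `IM` on a finite-dimensional space), `V` a compact Hausdorff manifold without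
boundary modelled on `ℝⁿ`, and `e₀ e₁ : C(M, V)` smooth maps, homotopic as continuous maps.  Then
there is a smooth `H : ℝ × M → V` with `H (t, ·) = e₀` for `t ≤ 1/4` and `H (t, ·) = e₁` for
`t ≥ 3/4` (Whitney embedding of `V`, normal retraction, smooth approximation relative to the
ends). [cite: HirschDT1976, Ch. 8 §1 and Ch. 4 §5] -/
theorem exists_contMDiff_homotopy_of_homotopic {EM HM : Type*} [NormedAddCommGroup EM]
    [NormedSpace ℝ EM] [FiniteDimensional ℝ EM] [TopologicalSpace HM]
    {IM : ModelWithCorners ℝ EM HM} {M : Type*} [TopologicalSpace M] [ChartedSpace HM M]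
    [IsManifold IM ∞ M] [CompactSpace M] [T2Space M]
    {n : ℕ} {V : Type*} [TopologicalSpace V] [ChartedSpace (EuclideanSpace ℝ (Fin n)) V]
    [IsManifold (𝓡 n) ∞ V] [CompactSpace V] [T2Space V]
    {e₀ e₁ : C(M, V)} (he₀ : ContMDiff IM (𝓡 n) ∞ e₀) (he₁ : ContMDiff IM (𝓡 n) ∞ e₁)
    (h : e₀.Homotopic e₁) :
    ∃ H : ℝ × M → V, ContMDiff (𝓘(ℝ, ℝ).prod IM) (𝓡 n) ∞ H ∧
      (∀ t : ℝ, t ≤ 1 / 4 → ∀ u, H (t, u) = e₀ u) ∧ (∀ t : ℝ, 3 / 4 ≤ t → ∀ u, H (t, u) = e₁ u) := by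
  obtain ⟨F⟩ := h
  rcases isEmpty_or_nonempty M with hM | hM
  · exact ⟨fun p => e₀ p.2, he₀.comp contMDiff_snd, fun t _ u => rfl,
      fun t _ u => (IsEmpty.false u).elim⟩
  haveI : Nonempty V := ⟨e₀ (Classical.arbitrary M)⟩
  -- ### Whitney embedding of `V` and a smooth normal retraction
  obtain ⟨N, e, he, hemb, hinj⟩ := exists_embedding_euclidean_of_compact (I := 𝓡 n) (M := V)
  obtain ⟨ε, hε, hTopen, hr, hre⟩ := exists_normalRetraction (I := 𝓡 n) he hemb.injective hinj
  have hreT : ∀ x : V, e x ∈ normalTube (𝓡 n) e ε ∧ normalRetraction (𝓡 n) e ε (e x) = x :=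
    fun x => by
      simpa using hre x 0 (Submodule.zero_mem _) (by simpa using hε)
  -- ### the reparametrised continuous homotopy, read in `ℝᴺ`
  set σ : ℝ → unitInterval := fun t => Set.projIcc 0 1 zero_le_one (3 * t - 1) with hσ
  have hσc : Continuous σ := continuous_projIcc.comp (by fun_prop)
  have hσ0 : ∀ t : ℝ, t ≤ 1 / 3 → σ t = 0 := fun t ht => by
    change Set.projIcc 0 1 zero_le_one (3 * t - 1) = 0
    rw [Set.projIcc_of_le_left _ (by linarith)]
    rfl
  have hσ1 : ∀ t : ℝ, 2 / 3 ≤ t → σ t = 1 := fun t ht => by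
    change Set.projIcc 0 1 zero_le_one (3 * t - 1) = 1
    rw [Set.projIcc_of_right_le _ (by linarith)]
    rfl
  set g₀ : ℝ × M → V := fun p => F (σ p.1, p.2) with hg₀
  have hg₀c : Continuous g₀ :=
    F.continuous.comp ((hσc.comp continuous_fst).prodMk continuous_snd)
  have hg₀0 : ∀ p : ℝ × M, p.1 ≤ 1 / 3 → g₀ p = e₀ p.2 := fun p hp => by
    rw [hg₀]
    dsimp only
    rw [hσ0 p.1 hp]
    exact F.apply_zero p.2
  have hg₀1 : ∀ p : ℝ × M, 2 / 3 ≤ p.1 → g₀ p = e₁ p.2 := fun p hp => by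
    rw [hg₀]
    dsimp only
    rw [hσ1 p.1 hp]
    exact F.apply_one p.2
  set f : ℝ × M → EuclideanSpace ℝ (Fin N) := fun p => e (g₀ p) with hf
  have hfc : Continuous f := he.continuous.comp hg₀c
  -- ### `f` is smooth near the closed set of end times
  set S : Set (ℝ × M) := {p | p.1 ≤ 1 / 4 ∨ 3 / 4 ≤ p.1} with hS
  set U : Set (ℝ × M) := {p | p.1 < 1 / 3 ∨ 2 / 3 < p.1} with hU
  have hSc : IsClosed S :=
    (isClosed_le continuous_fst continuous_const).union (isClosed_le continuous_const continuous_fst)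
  have hUo : IsOpen U :=
    (isOpen_lt continuous_fst continuous_const).union (isOpen_lt continuous_const continuous_fst)
  have hSU : S ⊆ U := fun p hp => hp.imp (fun h => by linarith) (fun h => by linarith)
  have hfU : ContMDiffOn (𝓘(ℝ, ℝ).prod IM) 𝓘(ℝ, EuclideanSpace ℝ (Fin N)) ∞ f U := by
    intro p hp
    rcases hp with hp | hp
    · have hev : f =ᶠ[𝓝 p] fun p : ℝ × M => e (e₀ p.2) := by
        filter_upwards [(isOpen_lt continuous_fst continuous_const).mem_nhds hp] with p' hp'
        change e (g₀ p') = e (e₀ p'.2)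
        rw [hg₀0 p' (le_of_lt hp')]
      exact (((he.comp (he₀.comp contMDiff_snd)).contMDiffAt).congr_of_eventuallyEq
        hev).contMDiffWithinAt
    · have hev : f =ᶠ[𝓝 p] fun p : ℝ × M => e (e₁ p.2) := by
        filter_upwards [(isOpen_lt continuous_const continuous_fst).mem_nhds hp] with p' hp'
        change e (g₀ p') = e (e₁ p'.2)
        rw [hg₀1 p' (le_of_lt hp')]
      exact (((he.comp (he₁.comp contMDiff_snd)).contMDiffAt).congr_of_eventuallyEq
        hev).contMDiffWithinAt
  -- ### tube margin and smooth approximation relative to `S`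
  obtain ⟨δ, hδ, hδT⟩ := (isCompact_range he.continuous).exists_cthickening_subset_open hTopen
    (range_subset_iff.2 fun x => (hreT x).1)
  obtain ⟨g, hgf, hgS, -⟩ := hfc.exists_contMDiff_approx_and_eqOn (𝓘(ℝ, ℝ).prod IM) ⊤
    continuous_const (fun _ => hδ) hSc (hUo.mem_nhdsSet.2 hSU) hfU
  have hgT : ∀ p, g p ∈ normalTube (𝓡 n) e ε := fun p =>
    hδT (Metric.mem_cthickening_of_dist_le _ (f p) _ _ ⟨g₀ p, rfl⟩ (hgf p).le)
  refine ⟨fun p => normalRetraction (𝓡 n) e ε (g p), hr.comp_contMDiff g.contMDiff hgT,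
    fun t ht u => ?_, fun t ht u => ?_⟩
  · have hS' : ((t, u) : ℝ × M) ∈ S := Or.inl ht
    change normalRetraction (𝓡 n) e ε (g (t, u)) = e₀ u
    rw [hgS hS']
    change normalRetraction (𝓡 n) e ε (e (g₀ (t, u))) = e₀ u
    rw [hg₀0 (t, u) (by change t ≤ 1 / 3; linarith)]
    exact (hreT _).2
  · have hS' : ((t, u) : ℝ × M) ∈ S := Or.inr ht
    change normalRetraction (𝓡 n) e ε (g (t, u)) = e₁ u
    rw [hgS hS']
    change normalRetraction (𝓡 n) e ε (e (g₀ (t, u))) = e₁ u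
    rw [hg₀1 (t, u) (by change 2 / 3 ≤ t; linarith)]
    exact (hreT _).2

end Literature.Topology.FourManifolds
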